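import Literature.AlgebraicGeometry.Resolution.WeightedCentreClassPinBridge
import Literature.AlgebraicGeometry.Resolution.WeightedCentreLevelProjection
import HarnessLib

/-!
# Weighted centres — the CORE of the restriction tower: THEOREM F★ for the cell's isotropy subgroups

Instrument for engine 1's `W(f)` TOY MODEL (cell `pub-rosobs`, LF-MODEL-eng1-g45 §6.2 REDUCTION, last step: "CONJECTURE L-F (N) follows from THEOREM F / LEMMA F∅ applied to
`ρ(X)` on `N_core`"), NOT a resolution theorem and NOT about the invariant of [AbramovichTemkinWlodarczyk2024].

The tower (`ZKernel.restrictFace`, files `WeightedCentreFace*`) speaks of automorphisms `A ∈ graded w 1 ⊓ baseFixing ⊓ 𝔄_1 ⊓ fixSlots V ⊓ Stab(C g)`; THEOREM F★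
(`IsGradedIso.eq_id_of_slotPinned`, tree) speaks of ring endomorphisms `Φ` with `IsGradedIso`, `IsIdModSigma`.  This file is the dictionary (`isIdModSigma_of_mem_level_one`,
`isGradedIso_of_mem`) and THEOREM F★ at the core in subgroup language (`eq_one_of_core`): on a core face (all weights `≥ p`, i.e. no light slot left) an isotropy `A` of the
list above without pure `σ^p`-term on the `W`-slots is trivial, provided `k` is perfect, `g` is `w`-homogeneous of weight `p(p+1)` and (P) holds at the `f`-class slots.

References: [AbramovichTemkinWlodarczyk2024, Thm. 5.3.1 (2)–(3) (p. 1578)]; [Lang2002, Ch. I §3, Ch. IV §1]; [Matsumura1987, §27 (p. 207)].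
-/

namespace Literature.AlgebraicGeometry.Resolution.WeightedBlowup.ZKernel

open Polynomial OrderFiltration LevelProjection Truncation

section Dictionary

variable {k : Type*} [CommRing k] {ι : Type*}

/-- `A ∈ 𝔄_1` ⇒ `A ≡ id (mod σ)` in the sense of `IsIdModSigma` (dictionary; bookkeeping). [cite: Matsumura1987, §27 (p. 207); Lang2002, Ch. I §3] -/
theorem isIdModSigma_of_mem_level_one {A : (MvPolynomial ι k)[X] ≃+* (MvPolynomial ι k)[X]} (h1 : A ∈ level (X : (MvPolynomial ι k)[X]) 1) :
    IsIdModSigma (A : (MvPolynomial ι k)[X] →+* (MvPolynomial ι k)[X]) := fun a => by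
  obtain ⟨z, hz⟩ := (mem_level.mp h1).2 (C a)
  rw [RingHom.coe_coe, hz, pow_one, Polynomial.coeff_add, Polynomial.coeff_C_zero, Polynomial.coeff_X_mul_zero, add_zero]

/-- `A ∈ graded w ρ ⊓ baseFixing ⊓ Stab(C g)` ⇒ `IsGradedIso w ρ g A` (dictionary; bookkeeping). [cite: AbramovichTemkinWlodarczyk2024, Thm. 5.3.1 (2)–(3) (p. 1578)] -/
theorem isGradedIso_of_mem {M : Type*} [AddCommGroup M] {w : ι → M} {ρ : M} {g : MvPolynomial ι k} {A : (MvPolynomial ι k)[X] ≃+* (MvPolynomial ι k)[X]}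
    (hg : A ∈ graded w ρ) (hb : A ∈ baseFixing) (hfix : A (C g) = C g) : IsGradedIso w ρ g (A : (MvPolynomial ι k)[X] →+* (MvPolynomial ι k)[X]) :=
  ⟨(mem_graded.mp hg).1, (mem_baseFixing.mp hb).1, hfix⟩

end Dictionary

section Core

variable {k : Type*} [Field k] {ι : Type*} [Fintype ι] [DecidableEq ι] (p : ℕ) [Fact p.Prime] [CharP k p]

/-- **THEOREM F★ AT THE CORE, subgroup language** (LF-MODEL §6.2 REDUCTION, last step): `k` perfect of characteristic `p`; all weights `≥ p` (a core face: no light slot);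
`g` `w`-homogeneous of weight `p(p+1)`; (P) at every `f`-class slot (weight `p+1`).  If `A ∈ graded w 1 ⊓ baseFixing ⊓ 𝔄_1` fixes `C g`, fixes every slot heavier than `p+1`,
and has no pure `σ^p`-term on any `W`-slot (weight `p`), then `A = 1`.  Contrapositive = COROLLARY L-F at the core: a non-trivial such isotropy has a pure `σ^p` `W`-term.
Instrument for engine 1's `W(f)` toy model, NOT a resolution theorem. [cite: AbramovichTemkinWlodarczyk2024, Thm. 5.3.1 (2)–(3) (p. 1578); Lang2002, Ch. IV §1] -/
theorem eq_one_of_core (hperf : ∀ x : k, ∃ y : k, y ^ p = x) {w : ι → ℚ} (hw : ∀ j, (p : ℚ) ≤ w j) {g : MvPolynomial ι k}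
    (hg : MvPolynomial.IsWeightedHomogeneous w g ((p : ℚ) * (p + 1)))
    {A : (MvPolynomial ι k)[X] ≃+* (MvPolynomial ι k)[X]} (hgr : A ∈ graded w (1 : ℚ)) (hb : A ∈ baseFixing) (h1 : A ∈ level (X : (MvPolynomial ι k)[X]) 1)
    (hfix : A (C g) = C g) (hV : ∀ j, (p : ℚ) + 1 < w j → A (C (MvPolynomial.X j)) = C (MvPolynomial.X j))
    (hW : ∀ n, w n = p → pureCoeff (A : (MvPolynomial ι k)[X] →+* (MvPolynomial ι k)[X]) n p = 0)
    (hP : ∀ i, w i = (p : ℚ) + 1 → SlotPinned w i g) : A = 1 := by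
  have hid : (A : (MvPolynomial ι k)[X] →+* (MvPolynomial ι k)[X]) = RingHom.id _ :=
    IsGradedIso.eq_id_of_slotPinned p hperf one_pos (fun j => by rw [mul_one]; exact hw j) (by rwa [mul_one])
      (isGradedIso_of_mem hgr hb hfix) (isIdModSigma_of_mem_level_one h1) (fun j hj => by rw [mul_one] at hj; exact hV j hj)
      (fun n hn => hW n (by rw [hn, mul_one])) (fun i hi => hP i (by rw [hi, mul_one]))
  refine RingEquiv.ext fun x => ?_
  have hx := congrArg (fun Φ : (MvPolynomial ι k)[X] →+* (MvPolynomial ι k)[X] => Φ x) hid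
  simpa using hx

end Core

end Literature.AlgebraicGeometry.Resolution.WeightedBlowup.ZKernel
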